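import Summits.BirchSwinnertonDyer.BirchSwinnertonDyer.Theorems.GenusKolyvaginAtTwoK4NegOrdinaryWitnessAtTwo
import Summits.BirchSwinnertonDyer.BirchSwinnertonDyer.Theorems.GenusKolyvaginAtTwoK4PosOffCutNonPhantomAtTwoIff
import HarnessLib

/-!
# Route `GenusKolyvaginAtTwo`, K₄⁻ kernel `K4Neg` (stmt-BirchSwinnertonDyer-31526), LINE 34 «twin_bsd_road⁻» v1.5:
# `(NPh_K)` AT EVERY 2-SPLIT FRAME FROM THE ORDINARY WITNESS — the F4″-shaped brick for the good-ordinary-at-2 cells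

Width seat `bsd-line-gk2-p5` g42 (cell `bsd-f1-sign2`), WIDTH-5 attach on route `GenusKolyvaginAtTwo` rev 59, lane `(NPh_K)` off
the cut.  `--supports stmt-BirchSwinnertonDyer-31526 --as helper`.  THEOREMS ONLY (no definition, no named fact, no `sorry`); standard
axioms.  **BSD is NOT proved by this file; `K4Neg` is NOT proved; no item is closed by it.**

WHAT.  The composition of LINE 34 consumes `(NPh_K)` in F4″'s shape: «for every `L ≥ 1`, every class of `H¹(K, E[2^L])` dying on
`Γ_{K(E[2^L])}` and Kummer at the places of `K` over `2` is `0`», at an admissible frame `K` with `2` split.  gk2-p5 g41 proved the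
exactness «F4″ ⟺ a level-2 witness at `v = 2` over `ℚ`» (`nonPhantomAtTwoPlaces_iff_levelTwoWitness_two`) and this seat's g42 file
`…K4NegOrdinaryWitnessAtTwo` gives such a witness at a place of GOOD ORDINARY reduction from ONE inertia element (`A ∘ A ≠ 0`).  Here
the two are composed:
* ★ `offCutNonPhantomAtTwo_of_inertia_datum_comp_ne_zero` — **`W/ℚ` with `ρ_{W,2^n}` onto for all `n ≥ 1`, `v ∋ 2` of good ORDINARY
  reduction, an inertial `τ ∈ I_{ℚ_v}` whose restriction acts on `E[4]` as `P ↦ P + A(2P)` with `A ∘ A ≠ 0`; `K` imaginary quadratic,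
  `d_K` odd, the two B₂ non-squares, `2` split in `K` ⟹ the F4″ conclusion: every phantom class of `H¹(K, E[2^L])` (`L ≥ 1`) Kummer at
  the places over `2` is zero.**  (So on good-ordinary cells with such a `τ` — e.g. `Δ_min ≡ 1 (mod 4)`, see the memo — the NPh-fed
  road `offCut_of_wall_U2_of_nonPhantom` of LINE 34 runs exactly as on the `2`-multiplicative slice.)
BSD is NOT proved by this.

References: [LawsonWuthrich2016] §3, §7.1, §8; [SerreInventiones1972] §1.11; [GrossLMS1991] §9 Prop. 9.1.
-/

set_option linter.dupNamespace false -- `Summit.<P>.<Sub>` repeats `BirchSwinnertonDyer` (D-0017)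
set_option autoImplicit false

noncomputable section

open scoped Classical NumberField

namespace Summit.BirchSwinnertonDyer.BirchSwinnertonDyer.Theorems.GenusExact.Lw2PhantomExclusion.OrdinaryWitness

open WeierstrassCurve Field NumberField IsDedekindDomain
open Literature.NumberTheory.GaloisRepresentations Literature.NumberTheory.EllipticCurves
open Summit.BirchSwinnertonDyer.BirchSwinnertonDyer.Theorems.GenusKolyTwistingPrime

variable (W : WeierstrassCurve ℚ) [W.IsElliptic]

/-- ★ **`(NPh_K)` IN F4″'s SHAPE FROM THE ORDINARY WITNESS.**  `W/ℚ` elliptic with `ρ_{W,2^n}` onto for all `n ≥ 1`; `v ∋ 2` a place of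
good ORDINARY reduction; `τ` an element of the inertia group `I_{ℚ_v}` whose restriction to `Γ_ℚ` acts on `E[4]` as `P ↦ P + A(2P)` with
`A ∘ A ≠ 0` (⟺ `τ` fixes `E[2]` and acts as `−1` on the `4`-torsion of the canonical line); `K` imaginary quadratic with `d_K` odd,
`d_K·(−|Δ|)`, `d_K·(−2|Δ|)` non-squares and `2` SPLIT in `K`.  Then for every `L ≥ 1`, every class of `H¹(K, E[2^L])` dying on
`Γ_{K(E[2^L])}` and Kummer at every place of `K` over `2` is ZERO.  Proof: the non-zero level-4 phantom of `H¹(ℚ, E[2])` (unique;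
exists by gk2-p4 g10) is not Kummer at `v` (`not_mem_selmerLocalKer_two_of_inertia_datum_comp_ne_zero`), which is a level-2 witness at
`v ∋ 2`; conclude by gk2-p5 g41's `offCutNonPhantomAtTwo_of_levelTwoWitness_two`.
[cite: LawsonWuthrich2016, §3, §7.1 and §8] [cite: SerreInventiones1972, §1.11 Prop. 11 and Cor.] -/
theorem offCutNonPhantomAtTwo_of_inertia_datum_comp_ne_zero
    (hρ : ∀ n : ℕ, 0 < n → W.HasSurjectiveModNGaloisRep ((2 : ℤ) ^ n))
    (v : HeightOneSpectrum (𝓞 ℚ)) (hv2 : ((2 : ℕ) : 𝓞 ℚ) ∈ v.asIdeal) (hgood : W.HasGoodReductionAt v)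
    (hord : ¬ (((2 : ℕ) : ℤ) ∣ W.frobeniusTraceAt v))
    {τ : absoluteGaloisGroup (v.adicCompletion ℚ)} (hτ : τ ∈ absInertia (v.adicCompletion ℚ))
    {A : geomTorsion W (2 : ℤ) →+ geomTorsion W (2 : ℤ)}
    (hA : ∀ P : geomTorsion W (4 : ℤ),
      ((absGaloisRestrict ℚ (v.adicCompletion ℚ) τ • P : geomTorsion W (4 : ℤ)) : geomPoints W) =
        (P : geomPoints W) + (A ⟨(2 : ℤ) • (P : geomPoints W), two_zsmul_mem_geomTorsion_two W P⟩ : geomPoints W))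
    (hAA : A.comp A ≠ 0)
    {K : Type} [Field K] [NumberField K] (hK : IsImaginaryQuadratic K) (hodd : Odd (NumberField.discr K))
    (hnsq₁ : ¬ IsSquare ((NumberField.discr K : ℚ) * -|W.Δ|))
    (hnsq₂ : ¬ IsSquare ((NumberField.discr K : ℚ) * (-(2 * |W.Δ|))))
    (h2K : ((Ideal.span {(2 : ℤ)}).primesOver (𝓞 K)).ncard = 2) :
    ∀ (L : ℕ), 1 ≤ L → ∀ z : galH1Torsion (W.baseChange K) ((2 ^ L : ℕ) : ℤ),
      (∀ ρ' ∈ torsionFixing (W.baseChange K) ((2 ^ L : ℕ) : ℤ), h1Eval (W.baseChange K) ((2 ^ L : ℕ) : ℤ) z ρ' = 0) →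
      (∀ w : HeightOneSpectrum (𝓞 K), ((2 : ℕ) : 𝓞 K) ∈ w.asIdeal →
        z ∈ selmerLocalKer (W.baseChange K) (w.adicCompletion K) ((2 ^ L : ℕ) : ℤ)) → z = 0 := by
  have hs2 : W.HasSurjectiveModNGaloisRep 2 := by simpa using hρ 1 one_pos
  have hs4 : W.HasSurjectiveModNGaloisRep 4 := by
    have h := hρ 2 two_pos
    norm_num at h
    exact h
  exact offCutNonPhantomAtTwo_of_levelTwoWitness_two W hρ hK hodd hnsq₁ hnsq₂ h2K
    ⟨v, hv2, fun z hz0 hz ↦ not_mem_selmerLocalKer_two_of_inertia_datum_comp_ne_zero W hs2 hs4 v hv2 hgood hord hz0 hz hτ hA hAA⟩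

end Summit.BirchSwinnertonDyer.BirchSwinnertonDyer.Theorems.GenusExact.Lw2PhantomExclusion.OrdinaryWitness

end
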